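import Summits.QuantumFields.YangMills.Theorems.ColdStartUniversalityLatticeLangevinGradientBoundCurvature
import Summits.QuantumFields.YangMills.Theorems.ColdStartUniversalityLatticeLangevinKernelActionContinuity
import HarnessLib

/-!
# Route `ColdStartUniversality` (fixed-cut-off package, Bakry–Émery side, GRADIENT half): the STATIC FLOW INEQUALITY
# `Λ'(s) ≥ (2 − K₀)·Λ(s)` behind the gradient bound, at one instant

Helper file (seat `ym-line-csu-p1`, g29; `--supports stmt-QuantumFields-24809`).  Third groundwork file for the weak gradient commutation
`Γ(P_t f) ≤ e^(−(2−K₀)t) P_t Γ(f)` of the SU(2) lattice Langevin (SZZ) semigroup at a fixed cut-off.  The semigroup proof (sequel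
`…GradientBoundFlow`) differentiates `Λ(s) = ∫ (P_s H)·Γ^A(P_(t−s)F) dμ_(β')` written WITHOUT spatial derivatives of the semigroup
(`Γ^A(u) = 𝓛(u²) − 2u𝓛u`, `𝓛` moved onto `P_s H` by symmetry), so that only Dynkin time-derivatives are needed; at each instant the four
Dynkin-class representatives `G ↔ P_sH`, `B ↔ P_s𝓛H = 𝓛G`, `u ↔ P_(t−s)F`, `v ↔ P_(t−s)𝓛F = 𝓛u` are `C³` compactly supported functions of
the real link coordinates, and the inequality `Λ' ≥ (2−K₀)Λ` becomes the STATIC statement of this file: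
* ★ `flow_value_eq_integral_mul_carre` — `∫ (𝓛G·u² − 2G·u·v) dμ = ∫ G·Γ^A(u) dμ`;
* ★★ `flow_deriv_ge_of_hessBound` — under the Hessian bound `hHess` (`K₀ = 24|β'|` by `wilson_hessBound`) and `G ≥ 0` on the group,
  `(2 − K₀)·∫ G·Γ^A(u) dμ ≤ ∫ (𝓛B·u² − 4𝓛G·uv + 2G(v² + u𝓛v)) dμ`
  (symmetry of `𝓛` on `C²`/`C³`, Leibniz, and the pointwise curvature inequality `generator_carre_sub_ge_of_hessBound`).
THEOREMS ONLY, no definition, no sorry.  HONEST FRAMING: fixed cut-off; nothing K-uniform in the route's scaling `β'_K → ∞`; no crux,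
rung or summit statement is proved; the Yang–Mills mass gap is NOT proved.
-/

set_option autoImplicit false

noncomputable section

namespace Summit.QuantumFields.YangMills.Theorems.ColdStartUniversality

open MeasureTheory Matrix Complex Finset
open scoped ComplexConjugate BigOperators Matrix
open Literature.MathematicalPhysics.QuantumFieldTheory
open Literature.MathematicalPhysics.QuantumLattice (fundamentalRep fundamentalLatticeRep continuous_fundamentalRep fundamentalRep_apply)

variable {L : ℕ} [NeZero L]

/-- ★ **The value of the flow functional**: for `C³` compactly supported `G, u, v` with `v∘coords = 𝓛u` on the group,
`∫ (𝓛G·u² − 2·G·u·v) dμ_(β') = ∫ G·Γ^A(u) dμ_(β')` (symmetry of `𝓛` and the Leibniz rule `𝓛(u²) = 2u𝓛u + Γ^A(u)`). [folklore] -/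
theorem flow_value_eq_integral_mul_carre (L : ℕ) [NeZero L] (β' : ℝ)
    {G u v : (Edge 3 L × Fin 2 × Fin 2 × Bool → ℝ) → ℝ} (hG : ContDiff ℝ 3 G) (hGc : HasCompactSupport G)
    (hu : ContDiff ℝ 3 u) (huc : HasCompactSupport u) (hv : ContDiff ℝ 3 v) :
    let coords : GaugeConfig 3 L (Matrix.specialUnitaryGroup (Fin 2) ℂ) → (Edge 3 L × Fin 2 × Fin 2 × Bool → ℝ) :=
      fun V q => (fun z : ℂ => if q.2.2.2 then z.im else z.re)
        ((fundamentalRep (Fin 2) (V q.1) : Matrix (Fin 2) (Fin 2) ℂ) q.2.1 q.2.2.1)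
    let A : GaugeConfig 3 L (Matrix.specialUnitaryGroup (Fin 2) ℂ) → (Edge 3 L × Fin 2 × Fin 2 × Bool) →
        (Edge 3 L × Fin 2 × Fin 2 × Bool) → ℝ := fun V i j =>
      ∑ n : Edge 3 L × NoiseIdx 2,
        (if n.1 = i.1 then (fun z : ℂ => if i.2.2.2 then z.im else z.re)
          ((latticeLangevinDynamics (fundamentalLatticeRep 2) β').noise
            (matrixConfig (fundamentalRep (Fin 2)) V) i.1 n.2 i.2.1 i.2.2.1) else 0) *
        (if n.1 = j.1 then (fun z : ℂ => if j.2.2.2 then z.im else z.re)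
          ((latticeLangevinDynamics (fundamentalLatticeRep 2) β').noise
            (matrixConfig (fundamentalRep (Fin 2)) V) j.1 n.2 j.2.1 j.2.2.1) else 0)
    let gen : ((Edge 3 L × Fin 2 × Fin 2 × Bool → ℝ) → ℝ) → GaugeConfig 3 L (Matrix.specialUnitaryGroup (Fin 2) ℂ) → ℝ :=
      fun h V =>
      (∑ i : Edge 3 L × Fin 2 × Fin 2 × Bool, fderiv ℝ h (coords V) (Pi.single i 1) *
          (fun z : ℂ => if i.2.2.2 then z.im else z.re)
            ((latticeLangevinDynamics (fundamentalLatticeRep 2) β').drift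
              (matrixConfig (fundamentalRep (Fin 2)) V) i.1 i.2.1 i.2.2.1) +
      1 / 2 * ∑ i : Edge 3 L × Fin 2 × Fin 2 × Bool, ∑ j : Edge 3 L × Fin 2 × Fin 2 × Bool,
        fderiv ℝ (fun z => fderiv ℝ h z (Pi.single i 1)) (coords V) (Pi.single j 1) *
          ∑ n : Edge 3 L × NoiseIdx 2,
            (if n.1 = i.1 then (fun z : ℂ => if i.2.2.2 then z.im else z.re)
              ((latticeLangevinDynamics (fundamentalLatticeRep 2) β').noise
                (matrixConfig (fundamentalRep (Fin 2)) V) i.1 n.2 i.2.1 i.2.2.1) else 0) *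
            (if n.1 = j.1 then (fun z : ℂ => if j.2.2.2 then z.im else z.re)
              ((latticeLangevinDynamics (fundamentalLatticeRep 2) β').noise
                (matrixConfig (fundamentalRep (Fin 2)) V) j.1 n.2 j.2.1 j.2.2.1) else 0))
    (∀ x, v (coords x) = gen u x) →
    ∫ x, (gen G x * (u (coords x) * u (coords x)) - 2 * (G (coords x) * (u (coords x) * v (coords x)))) ∂(wilsonMeasure (d := 3) (L := L) (fundamentalRep (Fin 2)) β') =
      ∫ x, G (coords x) * (∑ i : Edge 3 L × Fin 2 × Fin 2 × Bool, ∑ j : Edge 3 L × Fin 2 × Fin 2 × Bool, fderiv ℝ u (coords x) (Pi.single i 1) * fderiv ℝ u (coords x) (Pi.single j 1) * A x i j) ∂(wilsonMeasure (d := 3) (L := L) (fundamentalRep (Fin 2)) β') := by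
  intro coords A gen huv
  classical
  haveI := secondCountableTopology_su2
  haveI := borelSpace_config L
  set μ : Measure (GaugeConfig 3 L (Matrix.specialUnitaryGroup (Fin 2) ℂ)) := (wilsonMeasure (d := 3) (L := L) (fundamentalRep (Fin 2)) β') with hμ
  haveI : IsProbabilityMeasure μ :=
    isProbabilityMeasure_wilsonMeasure (d := 3) (L := L) (fundamentalRep (Fin 2)) (continuous_fundamentalRep (Fin 2)) β'
  have hco : Continuous coords := continuous_coords (L := L)
  have hInt : ∀ {Φ : (GaugeConfig 3 L (Matrix.specialUnitaryGroup (Fin 2) ℂ)) → ℝ}, Continuous Φ → Integrable Φ μ := fun hΦ => integrable_of_continuous_of_compactSpace hΦ μ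
  have hu2 : ContDiff ℝ 2 u := hu.of_le (by norm_num)
  have huu : ContDiff ℝ 3 (fun z => u z * u z) := hu.mul hu
  have huuc : HasCompactSupport (fun z => u z * u z) := huc.mul_left
  -- continuity of the players
  have cG : Continuous fun x => G (coords x) := hG.continuous.comp hco
  have cu : Continuous fun x => u (coords x) := hu.continuous.comp hco
  have cv : Continuous fun x => v (coords x) := hv.continuous.comp hco
  have cgenG : Continuous (gen G) := continuous_generator (L := L) β' (hG.of_le (by norm_num))
  have cgenu : Continuous (gen u) := continuous_generator (L := L) β' hu2
  have cgenuu : Continuous (gen fun z => u z * u z) := continuous_generator (L := L) β' (huu.of_le (by norm_num))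
  -- symmetry `∫ 𝓛G · u² = ∫ G · 𝓛(u²)`
  have hsymm : ∫ x, (u (coords x) * u (coords x)) * gen G x ∂μ = ∫ x, G (coords x) * gen (fun z => u z * u z) x ∂μ :=
    integral_mul_generator_symm L β' hG hGc huu huuc
  -- Leibniz on the group and the carré du champ as a continuous function
  have hleib : ∀ x, gen (fun z => u z * u z) x = u (coords x) * gen u x + u (coords x) * gen u x + (∑ i : Edge 3 L × Fin 2 × Fin 2 × Bool, ∑ j : Edge 3 L × Fin 2 × Fin 2 × Bool, fderiv ℝ u (coords x) (Pi.single i 1) * fderiv ℝ u (coords x) (Pi.single j 1) * A x i j) :=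
    fun x => generator_mul_coords L β' hu2 hu2 x
  have cΓ : Continuous fun x => (∑ i : Edge 3 L × Fin 2 × Fin 2 × Bool, ∑ j : Edge 3 L × Fin 2 × Fin 2 × Bool, fderiv ℝ u (coords x) (Pi.single i 1) * fderiv ℝ u (coords x) (Pi.single j 1) * A x i j) := by
    have h : (fun x => (∑ i : Edge 3 L × Fin 2 × Fin 2 × Bool, ∑ j : Edge 3 L × Fin 2 × Fin 2 × Bool, fderiv ℝ u (coords x) (Pi.single i 1) * fderiv ℝ u (coords x) (Pi.single j 1) * A x i j)) = fun x => gen (fun z => u z * u z) x - 2 * (u (coords x) * gen u x) := by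
      funext x; rw [hleib x]; ring
    rw [h]; exact cgenuu.sub (continuous_const.mul (cu.mul cgenu))
  -- assemble
  have i1 : Integrable (fun x => (u (coords x) * u (coords x)) * gen G x) μ := hInt ((cu.mul cu).mul cgenG)
  have i2 : Integrable (fun x => 2 * (G (coords x) * (u (coords x) * v (coords x)))) μ := (hInt (cG.mul (cu.mul cv))).const_mul 2
  have i3 : Integrable (fun x => G (coords x) * (∑ i : Edge 3 L × Fin 2 × Fin 2 × Bool, ∑ j : Edge 3 L × Fin 2 × Fin 2 × Bool, fderiv ℝ u (coords x) (Pi.single i 1) * fderiv ℝ u (coords x) (Pi.single j 1) * A x i j)) μ := hInt (cG.mul cΓ)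
  have e1 : ∫ x, (gen G x * (u (coords x) * u (coords x)) - 2 * (G (coords x) * (u (coords x) * v (coords x)))) ∂μ =
      ∫ x, (u (coords x) * u (coords x)) * gen G x ∂μ - 2 * ∫ x, G (coords x) * (u (coords x) * v (coords x)) ∂μ := by
    rw [← integral_const_mul, ← integral_sub i1 i2]
    exact integral_congr_ae (Filter.Eventually.of_forall fun x => by ring)
  have e2 : ∫ x, G (coords x) * gen (fun z => u z * u z) x ∂μ =
      2 * ∫ x, G (coords x) * (u (coords x) * v (coords x)) ∂μ + ∫ x, G (coords x) * (∑ i : Edge 3 L × Fin 2 × Fin 2 × Bool, ∑ j : Edge 3 L × Fin 2 × Fin 2 × Bool, fderiv ℝ u (coords x) (Pi.single i 1) * fderiv ℝ u (coords x) (Pi.single j 1) * A x i j) ∂μ := by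
    rw [← integral_const_mul, ← integral_add i2 i3]
    refine integral_congr_ae (Filter.Eventually.of_forall fun x => ?_)
    show G (coords x) * gen (fun z => u z * u z) x = 2 * (G (coords x) * (u (coords x) * v (coords x))) + G (coords x) * (∑ i : Edge 3 L × Fin 2 × Fin 2 × Bool, ∑ j : Edge 3 L × Fin 2 × Fin 2 × Bool, fderiv ℝ u (coords x) (Pi.single i 1) * fderiv ℝ u (coords x) (Pi.single j 1) * A x i j)
    rw [hleib x, huv x]; ring
  rw [e1, hsymm, e2]; ring

/-- ★★ **The static flow inequality** `Λ' ≥ (2 − K₀)·Λ`.  Under the frame Hessian bound `K₀` of the plaquette function, for `C³` compactly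
supported `G, B, u, v` with `B∘coords = 𝓛G`, `v∘coords = 𝓛u` and `G ≥ 0` on the group,
`(2 − K₀)·∫ G·Γ^A(u) dμ_(β') ≤ ∫ (𝓛B·u² − 4·𝓛G·u·v + 2·G·(v² + u·𝓛v)) dμ_(β')`.
(Right side `= ∫ G·(𝓛Γ(u) − 2Γ(u,𝓛u)) dμ = 2∫ G·Γ₂(u) dμ` by symmetry and Leibniz; then the pointwise `CD(1 − K₀/2, ∞)` inequality.)
[cite: BakryGentilLedoux2014, Thm 3.3.18 / (3.2.3)–(3.2.4) (gradient bound under CD(ρ,∞))] -/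
theorem flow_deriv_ge_of_hessBound (L : ℕ) [NeZero L] (β' K₀ : ℝ)
    (hHess : (∀ (V : (GaugeConfig 3 L (Matrix.specialUnitaryGroup (Fin 2) ℂ))) (Λ : (Edge 3 L × Fin (fundamentalLatticeRep 2).N × Fin (fundamentalLatticeRep 2).N × Bool → ℝ) →L[ℝ] ℝ),
      ∑ n : Edge 3 L × NoiseIdx (fundamentalLatticeRep 2).N, ∑ m : Edge 3 L × NoiseIdx (fundamentalLatticeRep 2).N,
        Λ ((fun q : Edge 3 L × Fin (fundamentalLatticeRep 2).N × Fin (fundamentalLatticeRep 2).N × Bool => if n.1 = q.1 then (fun z : ℂ => if q.2.2.2 then z.im else z.re) (((Real.sqrt 2 : ℂ) • ((fundamentalLatticeRep 2).lieProj (noiseDir n.2) * (fun (ee : Edge 3 L) => Matrix.of fun (i j : Fin (fundamentalLatticeRep 2).N) => (((fun (V : GaugeConfig 3 L (Matrix.specialUnitaryGroup (Fin 2) ℂ)) (q : Edge 3 L × Fin (fundamentalLatticeRep 2).N × Fin (fundamentalLatticeRep 2).N × Bool) => (fun z : ℂ => if q.2.2.2 then z.im else z.re) ((fundamentalRep (Fin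 2) (V q.1) : Matrix (Fin 2) (Fin 2) ℂ) q.2.1 q.2.2.1)) V (ee, i, j, false) : ℝ) : ℂ) + (((fun (V : GaugeConfig 3 L (Matrix.specialUnitaryGroup (Fin 2) ℂ)) (q : Edge 3 L × Fin (fundamentalLatticeRep 2).N × Fin (fundamentalLatticeRep 2).N × Bool) => (fun z : ℂ => if q.2.2.2 then z.im else z.re) ((fundamentalRep (Fin 2) (V q.1) : Matrix (Fin 2) (Fin 2) ℂ) q.2.1 q.2.2.1)) V (ee, i, j, true) : ℝ) : ℂ) * Complex.I) q.1)) q.2.1 q.2.2.1) else 0)) * Λ ((fun q : Edge 3 L × Fin (fundamentalLatticeRep 2).N × Fin (fundamentalLatticeRep 2).N × Bool => if m.1 = q.1 then (fun z : ℂ => if q.2.2.2 then z.im else z.re) (((Real.sqrt 2 : ℂ) • ((fundamentalLatticeRep 2).lieProj (noiseDir m.2) * (fun (ee : Edge 3 L) => Matrix.of fun (i j : Fin (fundamentalLatticeRep 2).N) => (((fun (V : GaugeConfig 3 L (Matrix.specialUnitaryGroup (Fin 2) ℂ)) (q : Edge 3 L × Fin (fundamentalLatticeRep 2).N × Fin (fundamentalLatticeRep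 2).N × Bool) => (fun z : ℂ => if q.2.2.2 then z.im else z.re) ((fundamentalRep (Fin 2) (V q.1) : Matrix (Fin 2) (Fin 2) ℂ) q.2.1 q.2.2.1)) V (ee, i, j, false) : ℝ) : ℂ) + (((fun (V : GaugeConfig 3 L (Matrix.specialUnitaryGroup (Fin 2) ℂ)) (q : Edge 3 L × Fin (fundamentalLatticeRep 2).N × Fin (fundamentalLatticeRep 2).N × Bool) => (fun z : ℂ => if q.2.2.2 then z.im else z.re) ((fundamentalRep (Fin 2) (V q.1) : Matrix (Fin 2) (Fin 2) ℂ) q.2.1 q.2.2.1)) V (ee, i, j, true) : ℝ) : ℂ) * Complex.I) q.1)) q.2.1 q.2.2.1) else 0)) *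
          fderiv ℝ (fun z : (Edge 3 L × Fin (fundamentalLatticeRep 2).N × Fin (fundamentalLatticeRep 2).N × Bool → ℝ) => fderiv ℝ (fun y : (Edge 3 L × Fin (fundamentalLatticeRep 2).N × Fin (fundamentalLatticeRep 2).N × Bool → ℝ) => β' * ∑ p : Plaquette 3 L, (rootedLoop (fun (ee : Edge 3 L) (i j : Fin (fundamentalLatticeRep 2).N) => ((y (ee, i, j, false) : ℝ) : ℂ) + ((y (ee, i, j, true) : ℝ) : ℂ) * Complex.I) (p.1, p.2.1.1) p.2.1.2 false).trace.re) z (fun q : Edge 3 L × Fin (fundamentalLatticeRep 2).N × Fin (fundamentalLatticeRep 2).N × Bool => if m.1 = q.1 then (fun z : ℂ => if q.2.2.2 then z.im else z.re) (((Real.sqrt 2 : ℂ) • ((fundamentalLatticeRep 2).lieProj (noiseDir m.2) * (fun (ee : Edge 3 L) => Matrix.of fun (i j : Fin (fundamentalLatticeRep 2).N) => ((z (ee, i, j, false) : ℝ) : ℂ) + ((z (ee, i, j, true) : ℝ) : ℂ) * Complex.I) q.1)) q.2.1 q.2.2.1) else 0)) ((fun (V : GaugeConfig 3 L (Matrix.specialUnitaryGroup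 (Fin 2) ℂ)) (q : Edge 3 L × Fin (fundamentalLatticeRep 2).N × Fin (fundamentalLatticeRep 2).N × Bool) => (fun z : ℂ => if q.2.2.2 then z.im else z.re) ((fundamentalRep (Fin 2) (V q.1) : Matrix (Fin 2) (Fin 2) ℂ) q.2.1 q.2.2.1)) V) (fun q : Edge 3 L × Fin (fundamentalLatticeRep 2).N × Fin (fundamentalLatticeRep 2).N × Bool => if n.1 = q.1 then (fun z : ℂ => if q.2.2.2 then z.im else z.re) (((Real.sqrt 2 : ℂ) • ((fundamentalLatticeRep 2).lieProj (noiseDir n.2) * (fun (ee : Edge 3 L) => Matrix.of fun (i j : Fin (fundamentalLatticeRep 2).N) => (((fun (V : GaugeConfig 3 L (Matrix.specialUnitaryGroup (Fin 2) ℂ)) (q : Edge 3 L × Fin (fundamentalLatticeRep 2).N × Fin (fundamentalLatticeRep 2).N × Bool) => (fun z : ℂ => if q.2.2.2 then z.im else z.re) ((fundamentalRep (Fin 2) (V q.1) : Matrix (Fin 2) (Fin 2) ℂ) q.2.1 q.2.2.1)) V (ee, i, j, false) : ℝ) : ℂ) + (((fun (V : GaugeConfig 3 L (Matrix.specialUnitaryGroup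 (Fin 2) ℂ)) (q : Edge 3 L × Fin (fundamentalLatticeRep 2).N × Fin (fundamentalLatticeRep 2).N × Bool) => (fun z : ℂ => if q.2.2.2 then z.im else z.re) ((fundamentalRep (Fin 2) (V q.1) : Matrix (Fin 2) (Fin 2) ℂ) q.2.1 q.2.2.1)) V (ee, i, j, true) : ℝ) : ℂ) * Complex.I) q.1)) q.2.1 q.2.2.1) else 0)
        ≤ K₀ * ∑ n : Edge 3 L × NoiseIdx (fundamentalLatticeRep 2).N, (Λ (fun q : Edge 3 L × Fin (fundamentalLatticeRep 2).N × Fin (fundamentalLatticeRep 2).N × Bool => if n.1 = q.1 then (fun z : ℂ => if q.2.2.2 then z.im else z.re) (((Real.sqrt 2 : ℂ) • ((fundamentalLatticeRep 2).lieProj (noiseDir n.2) * (fun (ee : Edge 3 L) => Matrix.of fun (i j : Fin (fundamentalLatticeRep 2).N) => (((fun (V : GaugeConfig 3 L (Matrix.specialUnitaryGroup (Fin 2) ℂ)) (q : Edge 3 L × Fin (fundamentalLatticeRep 2).N × Fin (fundamentalLatticeRep 2).N × Bool) => (fun z : ℂ => if q.2.2.2 then z.im else z.re) ((fundamentalRep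 (Fin 2) (V q.1) : Matrix (Fin 2) (Fin 2) ℂ) q.2.1 q.2.2.1)) V (ee, i, j, false) : ℝ) : ℂ) + (((fun (V : GaugeConfig 3 L (Matrix.specialUnitaryGroup (Fin 2) ℂ)) (q : Edge 3 L × Fin (fundamentalLatticeRep 2).N × Fin (fundamentalLatticeRep 2).N × Bool) => (fun z : ℂ => if q.2.2.2 then z.im else z.re) ((fundamentalRep (Fin 2) (V q.1) : Matrix (Fin 2) (Fin 2) ℂ) q.2.1 q.2.2.1)) V (ee, i, j, true) : ℝ) : ℂ) * Complex.I) q.1)) q.2.1 q.2.2.1) else 0)) ^ 2))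
    {G B u v : (Edge 3 L × Fin 2 × Fin 2 × Bool → ℝ) → ℝ} (hG : ContDiff ℝ 3 G) (hGc : HasCompactSupport G) (hB : ContDiff ℝ 3 B) (hBc : HasCompactSupport B)
    (hu : ContDiff ℝ 3 u) (huc : HasCompactSupport u) (hv : ContDiff ℝ 3 v) (hvc : HasCompactSupport v) :
    let coords : GaugeConfig 3 L (Matrix.specialUnitaryGroup (Fin 2) ℂ) → (Edge 3 L × Fin 2 × Fin 2 × Bool → ℝ) :=
      fun V q => (fun z : ℂ => if q.2.2.2 then z.im else z.re)
        ((fundamentalRep (Fin 2) (V q.1) : Matrix (Fin 2) (Fin 2) ℂ) q.2.1 q.2.2.1)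
    let A : GaugeConfig 3 L (Matrix.specialUnitaryGroup (Fin 2) ℂ) → (Edge 3 L × Fin 2 × Fin 2 × Bool) →
        (Edge 3 L × Fin 2 × Fin 2 × Bool) → ℝ := fun V i j =>
      ∑ n : Edge 3 L × NoiseIdx 2,
        (if n.1 = i.1 then (fun z : ℂ => if i.2.2.2 then z.im else z.re)
          ((latticeLangevinDynamics (fundamentalLatticeRep 2) β').noise
            (matrixConfig (fundamentalRep (Fin 2)) V) i.1 n.2 i.2.1 i.2.2.1) else 0) *
        (if n.1 = j.1 then (fun z : ℂ => if j.2.2.2 then z.im else z.re)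
          ((latticeLangevinDynamics (fundamentalLatticeRep 2) β').noise
            (matrixConfig (fundamentalRep (Fin 2)) V) j.1 n.2 j.2.1 j.2.2.1) else 0)
    let gen : ((Edge 3 L × Fin 2 × Fin 2 × Bool → ℝ) → ℝ) → GaugeConfig 3 L (Matrix.specialUnitaryGroup (Fin 2) ℂ) → ℝ :=
      fun h V =>
      (∑ i : Edge 3 L × Fin 2 × Fin 2 × Bool, fderiv ℝ h (coords V) (Pi.single i 1) *
          (fun z : ℂ => if i.2.2.2 then z.im else z.re)
            ((latticeLangevinDynamics (fundamentalLatticeRep 2) β').drift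
              (matrixConfig (fundamentalRep (Fin 2)) V) i.1 i.2.1 i.2.2.1) +
      1 / 2 * ∑ i : Edge 3 L × Fin 2 × Fin 2 × Bool, ∑ j : Edge 3 L × Fin 2 × Fin 2 × Bool,
        fderiv ℝ (fun z => fderiv ℝ h z (Pi.single i 1)) (coords V) (Pi.single j 1) *
          ∑ n : Edge 3 L × NoiseIdx 2,
            (if n.1 = i.1 then (fun z : ℂ => if i.2.2.2 then z.im else z.re)
              ((latticeLangevinDynamics (fundamentalLatticeRep 2) β').noise
                (matrixConfig (fundamentalRep (Fin 2)) V) i.1 n.2 i.2.1 i.2.2.1) else 0) *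
            (if n.1 = j.1 then (fun z : ℂ => if j.2.2.2 then z.im else z.re)
              ((latticeLangevinDynamics (fundamentalLatticeRep 2) β').noise
                (matrixConfig (fundamentalRep (Fin 2)) V) j.1 n.2 j.2.1 j.2.2.1) else 0))
    (∀ x, B (coords x) = gen G x) → (∀ x, v (coords x) = gen u x) → (∀ x, 0 ≤ G (coords x)) →
    (2 - K₀) * ∫ x, G (coords x) * (∑ i : Edge 3 L × Fin 2 × Fin 2 × Bool, ∑ j : Edge 3 L × Fin 2 × Fin 2 × Bool, fderiv ℝ u (coords x) (Pi.single i 1) * fderiv ℝ u (coords x) (Pi.single j 1) * A x i j) ∂(wilsonMeasure (d := 3) (L := L) (fundamentalRep (Fin 2)) β') ≤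
      ∫ x, (gen B x * (u (coords x) * u (coords x)) - 4 * (gen G x * (u (coords x) * v (coords x))) +
        2 * (G (coords x) * (v (coords x) * v (coords x) + u (coords x) * gen v x))) ∂(wilsonMeasure (d := 3) (L := L) (fundamentalRep (Fin 2)) β') := by
  intro coords A gen hBG huv hG0
  classical
  haveI := secondCountableTopology_su2
  haveI := borelSpace_config L
  set μ : Measure (GaugeConfig 3 L (Matrix.specialUnitaryGroup (Fin 2) ℂ)) := (wilsonMeasure (d := 3) (L := L) (fundamentalRep (Fin 2)) β') with hμ
  haveI : IsProbabilityMeasure μ :=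
    isProbabilityMeasure_wilsonMeasure (d := 3) (L := L) (fundamentalRep (Fin 2)) (continuous_fundamentalRep (Fin 2)) β'
  have hco : Continuous coords := continuous_coords (L := L)
  have hInt : ∀ {Φ : (GaugeConfig 3 L (Matrix.specialUnitaryGroup (Fin 2) ℂ)) → ℝ}, Continuous Φ → Integrable Φ μ := fun hΦ => integrable_of_continuous_of_compactSpace hΦ μ
  have hG2 : ContDiff ℝ 2 G := hG.of_le (by norm_num)
  have hu2 : ContDiff ℝ 2 u := hu.of_le (by norm_num)
  have hv2 : ContDiff ℝ 2 v := hv.of_le (by norm_num)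
  have huu : ContDiff ℝ 3 (fun z => u z * u z) := hu.mul hu
  have huuc : HasCompactSupport (fun z => u z * u z) := huc.mul_left
  have huv3 : ContDiff ℝ 3 (fun z => u z * v z) := hu.mul hv
  have huvc : HasCompactSupport (fun z => u z * v z) := hvc.mul_left
  -- the ambient frame carré `Gam u = Σ_n (W_n u)²`, a `C²` function
  obtain ⟨s, c, hs, -, -, -, -⟩ := exists_noiseFrame L
  set s2 : (Edge 3 L × NoiseIdx (fundamentalLatticeRep 2).N) → ((Edge 3 L × Fin 2 × Fin 2 × Bool → ℝ) →L[ℝ] (Edge 3 L × Fin 2 × Fin 2 × Bool → ℝ)) := s with hs2def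
  have hs2 : ∀ (n : Edge 3 L × NoiseIdx (fundamentalLatticeRep 2).N) (y : (Edge 3 L × Fin 2 × Fin 2 × Bool → ℝ)), s2 n y = (fun q : Edge 3 L × Fin (fundamentalLatticeRep 2).N × Fin (fundamentalLatticeRep 2).N × Bool => if n.1 = q.1 then (fun z : ℂ => if q.2.2.2 then z.im else z.re) (((Real.sqrt 2 : ℂ) • ((fundamentalLatticeRep 2).lieProj (noiseDir n.2) * (fun (ee : Edge 3 L) => Matrix.of fun (i j : Fin (fundamentalLatticeRep 2).N) => ((y (ee, i, j, false) : ℝ) : ℂ) + ((y (ee, i, j, true) : ℝ) : ℂ) * Complex.I) q.1)) q.2.1 q.2.2.1) else 0) := fun n y => hs n y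
  set Gu : (Edge 3 L × Fin 2 × Fin 2 × Bool → ℝ) → ℝ := fun z => ∑ n, (fderiv ℝ u z (s2 n z)) ^ 2 with hGu
  have hGu_eq : (fun z : (Edge 3 L × Fin 2 × Fin 2 × Bool → ℝ) => ∑ n : Edge 3 L × NoiseIdx (fundamentalLatticeRep 2).N, (fderiv ℝ u z (fun q : Edge 3 L × Fin (fundamentalLatticeRep 2).N × Fin (fundamentalLatticeRep 2).N × Bool => if n.1 = q.1 then (fun z : ℂ => if q.2.2.2 then z.im else z.re) (((Real.sqrt 2 : ℂ) • ((fundamentalLatticeRep 2).lieProj (noiseDir n.2) * (fun (ee : Edge 3 L) => Matrix.of fun (i j : Fin (fundamentalLatticeRep 2).N) => ((z (ee, i, j, false) : ℝ) : ℂ) + ((z (ee, i, j, true) : ℝ) : ℂ) * Complex.I) q.1)) q.2.1 q.2.2.1) else 0)) ^ 2) = Gu := by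
    funext z
    show (∑ n : Edge 3 L × NoiseIdx (fundamentalLatticeRep 2).N, (fderiv ℝ u z (fun q : Edge 3 L × Fin (fundamentalLatticeRep 2).N × Fin (fundamentalLatticeRep 2).N × Bool => if n.1 = q.1 then (fun z : ℂ => if q.2.2.2 then z.im else z.re) (((Real.sqrt 2 : ℂ) • ((fundamentalLatticeRep 2).lieProj (noiseDir n.2) * (fun (ee : Edge 3 L) => Matrix.of fun (i j : Fin (fundamentalLatticeRep 2).N) => ((z (ee, i, j, false) : ℝ) : ℂ) + ((z (ee, i, j, true) : ℝ) : ℂ) * Complex.I) q.1)) q.2.1 q.2.2.1) else 0)) ^ 2) = ∑ n, (fderiv ℝ u z (s2 n z)) ^ 2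
    refine Finset.sum_congr rfl fun n _ => ?_
    rw [hs2 n z]
  have hGuC : ContDiff ℝ 2 Gu := ContDiff.sum fun n _ => (contDiff_frameDeriv (k := 2) hu (s2 n)).pow 2
  -- `Γ^A(u) = Gu ∘ coords` on the group
  have hΓGu : ∀ x, (∑ i : Edge 3 L × Fin 2 × Fin 2 × Bool, ∑ j : Edge 3 L × Fin 2 × Fin 2 × Bool, fderiv ℝ u (coords x) (Pi.single i 1) * fderiv ℝ u (coords x) (Pi.single j 1) * A x i j) = Gu (coords x) := by
    intro x
    have h : (∑ i : Edge 3 L × Fin 2 × Fin 2 × Bool, ∑ j : Edge 3 L × Fin 2 × Fin 2 × Bool, fderiv ℝ u (coords x) (Pi.single i 1) * fderiv ℝ u (coords x) (Pi.single j 1) * A x i j) =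
        ∑ n : Edge 3 L × NoiseIdx (fundamentalLatticeRep 2).N, fderiv ℝ u (coords x) (fun q : Edge 3 L × Fin (fundamentalLatticeRep 2).N × Fin (fundamentalLatticeRep 2).N × Bool => if n.1 = q.1 then (fun z : ℂ => if q.2.2.2 then z.im else z.re) (((Real.sqrt 2 : ℂ) • ((fundamentalLatticeRep 2).lieProj (noiseDir n.2) * (fun (ee : Edge 3 L) => Matrix.of fun (i j : Fin (fundamentalLatticeRep 2).N) => ((coords x (ee, i, j, false) : ℝ) : ℂ) + ((coords x (ee, i, j, true) : ℝ) : ℂ) * Complex.I) q.1)) q.2.1 q.2.2.1) else 0) * fderiv ℝ u (coords x) (fun q : Edge 3 L × Fin (fundamentalLatticeRep 2).N × Fin (fundamentalLatticeRep 2).N × Bool => if n.1 = q.1 then (fun z : ℂ => if q.2.2.2 then z.im else z.re) (((Real.sqrt 2 : ℂ) • ((fundamentalLatticeRep 2).lieProj (noiseDir n.2) * (fun (ee : Edge 3 L) => Matrix.of fun (i j : Fin (fundamentalLatticeRep 2).N) => ((coords x (ee, i, j, false) : ℝ) : ℂ) + ((coords x (ee, i, j, true) : ℝ) : ℂ) *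 Complex.I) q.1)) q.2.1 q.2.2.1) else 0) :=
      carre_eq_sum_frameDeriv_mul L β' u u x
    rw [h]
    show _ = ∑ n, (fderiv ℝ u (coords x) (s2 n (coords x))) ^ 2
    refine Finset.sum_congr rfl fun n _ => ?_
    rw [← hs2 n (coords x), sq]
  -- continuity of the players
  have cG : Continuous fun x => G (coords x) := hG.continuous.comp hco
  have cu : Continuous fun x => u (coords x) := hu.continuous.comp hco
  have cv : Continuous fun x => v (coords x) := hv.continuous.comp hco
  have cGu : Continuous fun x => Gu (coords x) := hGuC.continuous.comp hco
  have cgenG : Continuous (gen G) := continuous_generator (L := L) β' hG2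
  have cgenB : Continuous (gen B) := continuous_generator (L := L) β' (hB.of_le (by norm_num))
  have cgenu : Continuous (gen u) := continuous_generator (L := L) β' hu2
  have cgenv : Continuous (gen v) := continuous_generator (L := L) β' hv2
  have cgenuu : Continuous (gen fun z => u z * u z) := continuous_generator (L := L) β' (huu.of_le (by norm_num))
  have cgenuv : Continuous (gen fun z => u z * v z) := continuous_generator (L := L) β' (huv3.of_le (by norm_num))
  have cgenGu : Continuous (gen Gu) := continuous_generator (L := L) β' hGuC
  have cΓ : Continuous fun x => (∑ i : Edge 3 L × Fin 2 × Fin 2 × Bool, ∑ j : Edge 3 L × Fin 2 × Fin 2 × Bool, fderiv ℝ u (coords x) (Pi.single i 1) * fderiv ℝ u (coords x) (Pi.single j 1) * A x i j) := by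
    rw [show (fun x => (∑ i : Edge 3 L × Fin 2 × Fin 2 × Bool, ∑ j : Edge 3 L × Fin 2 × Fin 2 × Bool, fderiv ℝ u (coords x) (Pi.single i 1) * fderiv ℝ u (coords x) (Pi.single j 1) * A x i j)) = fun x => Gu (coords x) from funext hΓGu]; exact cGu
  have cΓuv : Continuous fun x => (∑ i : Edge 3 L × Fin 2 × Fin 2 × Bool, ∑ j : Edge 3 L × Fin 2 × Fin 2 × Bool, fderiv ℝ u (coords x) (Pi.single i 1) * fderiv ℝ v (coords x) (Pi.single j 1) * A x i j) := by
    have hleib : ∀ x, gen (fun z => u z * v z) x = u (coords x) * gen v x + v (coords x) * gen u x + (∑ i : Edge 3 L × Fin 2 × Fin 2 × Bool, ∑ j : Edge 3 L × Fin 2 × Fin 2 × Bool, fderiv ℝ u (coords x) (Pi.single i 1) * fderiv ℝ v (coords x) (Pi.single j 1) * A x i j) :=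
      fun x => generator_mul_coords L β' hu2 hv2 x
    have h : (fun x => (∑ i : Edge 3 L × Fin 2 × Fin 2 × Bool, ∑ j : Edge 3 L × Fin 2 × Fin 2 × Bool, fderiv ℝ u (coords x) (Pi.single i 1) * fderiv ℝ v (coords x) (Pi.single j 1) * A x i j)) = fun x => gen (fun z => u z * v z) x - u (coords x) * gen v x - v (coords x) * gen u x := by
      funext x; rw [hleib x]; ring
    rw [h]; exact (cgenuv.sub (cu.mul cgenv)).sub (cv.mul cgenu)
  -- (1) symmetry moves: `∫ 𝓛B·u² = ∫ B·𝓛(u²) = ∫ 𝓛G·𝓛(u²)`, `∫ 𝓛G·(uv) = ∫ G·𝓛(uv)`, `∫ 𝓛G·Gu = ∫ G·𝓛Gu`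
  have hS1 : ∫ x, gen B x * (u (coords x) * u (coords x)) ∂μ = ∫ x, gen G x * gen (fun z => u z * u z) x ∂μ := by
    have h := integral_mul_generator_symm L β' hB hBc huu huuc
    calc ∫ x, gen B x * (u (coords x) * u (coords x)) ∂μ = ∫ x, (u (coords x) * u (coords x)) * gen B x ∂μ :=
          integral_congr_ae (Filter.Eventually.of_forall fun x => mul_comm _ _)
      _ = ∫ x, B (coords x) * gen (fun z => u z * u z) x ∂μ := h
      _ = ∫ x, gen G x * gen (fun z => u z * u z) x ∂μ :=
          integral_congr_ae (Filter.Eventually.of_forall fun x => by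
            show B (coords x) * gen (fun z => u z * u z) x = gen G x * gen (fun z => u z * u z) x
            rw [hBG x])
  have hS2 : ∫ x, gen G x * (u (coords x) * v (coords x)) ∂μ = ∫ x, G (coords x) * gen (fun z => u z * v z) x ∂μ := by
    have h := integral_mul_generator_symm L β' hG hGc huv3 huvc
    calc ∫ x, gen G x * (u (coords x) * v (coords x)) ∂μ = ∫ x, (u (coords x) * v (coords x)) * gen G x ∂μ :=
          integral_congr_ae (Filter.Eventually.of_forall fun x => mul_comm _ _)
      _ = ∫ x, G (coords x) * gen (fun z => u z * v z) x ∂μ := h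
  have hS3 : ∫ x, gen G x * Gu (coords x) ∂μ = ∫ x, G (coords x) * gen Gu x ∂μ := by
    have h := integral_mul_generator_symm_of_contDiff_two L β' hG2 hGuC
    calc ∫ x, gen G x * Gu (coords x) ∂μ = ∫ x, Gu (coords x) * gen G x ∂μ :=
          integral_congr_ae (Filter.Eventually.of_forall fun x => mul_comm _ _)
      _ = ∫ x, G (coords x) * gen Gu x ∂μ := h
  -- (2) Leibniz on the group
  have hLuu : ∀ x, gen (fun z => u z * u z) x = 2 * (u (coords x) * v (coords x)) + Gu (coords x) := by
    intro x
    have h : gen (fun z => u z * u z) x = u (coords x) * gen u x + u (coords x) * gen u x + (∑ i : Edge 3 L × Fin 2 × Fin 2 × Bool, ∑ j : Edge 3 L × Fin 2 × Fin 2 × Bool, fderiv ℝ u (coords x) (Pi.single i 1) * fderiv ℝ u (coords x) (Pi.single j 1) * A x i j) :=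
      generator_mul_coords L β' hu2 hu2 x
    rw [← hΓGu x, huv x, h]; ring
  have hLuv : ∀ x, gen (fun z => u z * v z) x - u (coords x) * gen v x - v (coords x) * v (coords x) = (∑ i : Edge 3 L × Fin 2 × Fin 2 × Bool, ∑ j : Edge 3 L × Fin 2 × Fin 2 × Bool, fderiv ℝ u (coords x) (Pi.single i 1) * fderiv ℝ v (coords x) (Pi.single j 1) * A x i j) := by
    intro x
    have h : gen (fun z => u z * v z) x = u (coords x) * gen v x + v (coords x) * gen u x + (∑ i : Edge 3 L × Fin 2 × Fin 2 × Bool, ∑ j : Edge 3 L × Fin 2 × Fin 2 × Bool, fderiv ℝ u (coords x) (Pi.single i 1) * fderiv ℝ v (coords x) (Pi.single j 1) * A x i j) :=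
      generator_mul_coords L β' hu2 hv2 x
    rw [h, ← huv x]; ring
  -- (3) the right side equals `∫ G·(𝓛Gu − 2Γ^A(u,v))`
  have hRHS : ∫ x, (gen B x * (u (coords x) * u (coords x)) - 4 * (gen G x * (u (coords x) * v (coords x))) +
        2 * (G (coords x) * (v (coords x) * v (coords x) + u (coords x) * gen v x))) ∂μ =
      ∫ x, G (coords x) * (gen Gu x - 2 * (∑ i : Edge 3 L × Fin 2 × Fin 2 × Bool, ∑ j : Edge 3 L × Fin 2 × Fin 2 × Bool, fderiv ℝ u (coords x) (Pi.single i 1) * fderiv ℝ v (coords x) (Pi.single j 1) * A x i j)) ∂μ := by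
    have i1 : Integrable (fun x => gen B x * (u (coords x) * u (coords x))) μ := hInt (cgenB.mul (cu.mul cu))
    have i2 : Integrable (fun x => gen G x * (u (coords x) * v (coords x))) μ := hInt (cgenG.mul (cu.mul cv))
    have i3 : Integrable (fun x => G (coords x) * (v (coords x) * v (coords x) + u (coords x) * gen v x)) μ :=
      hInt (cG.mul ((cv.mul cv).add (cu.mul cgenv)))
    have i4 : Integrable (fun x => gen G x * gen (fun z => u z * u z) x) μ := hInt (cgenG.mul cgenuu)
    have i5 : Integrable (fun x => gen G x * Gu (coords x)) μ := hInt (cgenG.mul cGu)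
    have i6 : Integrable (fun x => G (coords x) * gen (fun z => u z * v z) x) μ := hInt (cG.mul cgenuv)
    have i7 : Integrable (fun x => G (coords x) * gen Gu x) μ := hInt (cG.mul cgenGu)
    have i8 : Integrable (fun x => G (coords x) * (∑ i : Edge 3 L × Fin 2 × Fin 2 × Bool, ∑ j : Edge 3 L × Fin 2 × Fin 2 × Bool, fderiv ℝ u (coords x) (Pi.single i 1) * fderiv ℝ v (coords x) (Pi.single j 1) * A x i j)) μ := hInt (cG.mul cΓuv)
    have i2' : Integrable (fun x => 4 * (gen G x * (u (coords x) * v (coords x)))) μ := i2.const_mul 4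
    have i3' : Integrable (fun x => 2 * (G (coords x) * (v (coords x) * v (coords x) + u (coords x) * gen v x))) μ := i3.const_mul 2
    have i12 : Integrable (fun x => gen B x * (u (coords x) * u (coords x)) - 4 * (gen G x * (u (coords x) * v (coords x)))) μ := i1.sub i2'
    have eL : ∫ x, (gen B x * (u (coords x) * u (coords x)) - 4 * (gen G x * (u (coords x) * v (coords x))) +
          2 * (G (coords x) * (v (coords x) * v (coords x) + u (coords x) * gen v x))) ∂μ =
        ∫ x, gen B x * (u (coords x) * u (coords x)) ∂μ - 4 * ∫ x, gen G x * (u (coords x) * v (coords x)) ∂μ +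
          2 * ∫ x, G (coords x) * (v (coords x) * v (coords x) + u (coords x) * gen v x) ∂μ := by
      rw [← integral_const_mul, ← integral_const_mul, ← integral_sub i1 i2', ← integral_add i12 i3']
    have i2'' : Integrable (fun x => 2 * (gen G x * (u (coords x) * v (coords x)))) μ := i2.const_mul 2
    have e4 : ∫ x, gen G x * gen (fun z => u z * u z) x ∂μ = 2 * ∫ x, gen G x * (u (coords x) * v (coords x)) ∂μ + ∫ x, gen G x * Gu (coords x) ∂μ := by
      rw [← integral_const_mul, ← integral_add i2'' i5]
      refine integral_congr_ae (Filter.Eventually.of_forall fun x => ?_)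
      show gen G x * gen (fun z => u z * u z) x = 2 * (gen G x * (u (coords x) * v (coords x))) + gen G x * Gu (coords x)
      rw [hLuu x]; ring
    have i6' : Integrable (fun x => 2 * (G (coords x) * gen (fun z => u z * v z) x)) μ := i6.const_mul 2
    have i76 : Integrable (fun x => G (coords x) * gen Gu x - 2 * (G (coords x) * gen (fun z => u z * v z) x)) μ := i7.sub i6'
    have eR : ∫ x, G (coords x) * (gen Gu x - 2 * (∑ i : Edge 3 L × Fin 2 × Fin 2 × Bool, ∑ j : Edge 3 L × Fin 2 × Fin 2 × Bool, fderiv ℝ u (coords x) (Pi.single i 1) * fderiv ℝ v (coords x) (Pi.single j 1) * A x i j)) ∂μ =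
        ∫ x, G (coords x) * gen Gu x ∂μ - 2 * ∫ x, G (coords x) * gen (fun z => u z * v z) x ∂μ +
          2 * ∫ x, G (coords x) * (v (coords x) * v (coords x) + u (coords x) * gen v x) ∂μ := by
      rw [← integral_const_mul, ← integral_const_mul, ← integral_sub i7 i6', ← integral_add i76 i3']
      refine integral_congr_ae (Filter.Eventually.of_forall fun x => ?_)
      show G (coords x) * (gen Gu x - 2 * (∑ i : Edge 3 L × Fin 2 × Fin 2 × Bool, ∑ j : Edge 3 L × Fin 2 × Fin 2 × Bool, fderiv ℝ u (coords x) (Pi.single i 1) * fderiv ℝ v (coords x) (Pi.single j 1) * A x i j)) =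
        G (coords x) * gen Gu x - 2 * (G (coords x) * gen (fun z => u z * v z) x) + 2 * (G (coords x) * (v (coords x) * v (coords x) + u (coords x) * gen v x))
      rw [← hLuv x]; ring
    rw [eL, hS1, e4, hS2, hS3, eR]; ring
  -- (4) pointwise curvature and positivity of `G`
  have hpt : ∀ x, (2 - K₀) * (∑ i : Edge 3 L × Fin 2 × Fin 2 × Bool, ∑ j : Edge 3 L × Fin 2 × Fin 2 × Bool, fderiv ℝ u (coords x) (Pi.single i 1) * fderiv ℝ u (coords x) (Pi.single j 1) * A x i j) ≤ gen Gu x - 2 * (∑ i : Edge 3 L × Fin 2 × Fin 2 × Bool, ∑ j : Edge 3 L × Fin 2 × Fin 2 × Bool, fderiv ℝ u (coords x) (Pi.single i 1) * fderiv ℝ v (coords x) (Pi.single j 1) * A x i j) := by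
    intro x
    have h := generator_carre_sub_ge_of_hessBound L β' K₀ hHess hu hv2 huv x
    rw [hGu_eq] at h
    exact h
  rw [hRHS, ← integral_const_mul]
  have iL : Integrable (fun x => (2 - K₀) * (G (coords x) * (∑ i : Edge 3 L × Fin 2 × Fin 2 × Bool, ∑ j : Edge 3 L × Fin 2 × Fin 2 × Bool, fderiv ℝ u (coords x) (Pi.single i 1) * fderiv ℝ u (coords x) (Pi.single j 1) * A x i j))) μ := (hInt (cG.mul cΓ)).const_mul _
  have iR : Integrable (fun x => G (coords x) * (gen Gu x - 2 * (∑ i : Edge 3 L × Fin 2 × Fin 2 × Bool, ∑ j : Edge 3 L × Fin 2 × Fin 2 × Bool, fderiv ℝ u (coords x) (Pi.single i 1) * fderiv ℝ v (coords x) (Pi.single j 1) * A x i j))) μ :=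
    hInt (cG.mul (cgenGu.sub (continuous_const.mul cΓuv)))
  refine integral_mono iL iR fun x => ?_
  have hx := mul_le_mul_of_nonneg_left (hpt x) (hG0 x)
  calc (2 - K₀) * (G (coords x) * (∑ i : Edge 3 L × Fin 2 × Fin 2 × Bool, ∑ j : Edge 3 L × Fin 2 × Fin 2 × Bool, fderiv ℝ u (coords x) (Pi.single i 1) * fderiv ℝ u (coords x) (Pi.single j 1) * A x i j)) = G (coords x) * ((2 - K₀) * (∑ i : Edge 3 L × Fin 2 × Fin 2 × Bool, ∑ j : Edge 3 L × Fin 2 × Fin 2 × Bool, fderiv ℝ u (coords x) (Pi.single i 1) * fderiv ℝ u (coords x) (Pi.single j 1) * A x i j)) := by ring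
    _ ≤ G (coords x) * (gen Gu x - 2 * (∑ i : Edge 3 L × Fin 2 × Fin 2 × Bool, ∑ j : Edge 3 L × Fin 2 × Fin 2 × Bool, fderiv ℝ u (coords x) (Pi.single i 1) * fderiv ℝ v (coords x) (Pi.single j 1) * A x i j)) := hx

end Summit.QuantumFields.YangMills.Theorems.ColdStartUniversality
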